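import Literature.Barriers.NavierStokesRegularity.NavierStokesInequalityOscillatoryProcesses
import Literature.Barriers.NavierStokesRegularity.NavierStokesInequalityProfileIntegrals
import Literature.Barriers.NavierStokesRegularity.NavierStokesInequalityParamCalculus
import HarnessLib

/-!
# Uniform convergence with derivatives of the oscillatory integrals of (4.16) (Ożański 2017, (4.18), (4.22))

Barrier catalogue support file for `NavierStokesRegularity` (D-0021), on the discharge path of
fact D-II `Literature.Barriers.NavierStokesRegularity.NSIProfiles_of_arrangement`
(`NavierStokesInequalityProfiles`; W. S. Ożański, arXiv:1709.00602v4, §4.1 and §4.3). By (4.16),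
`(qᵏ_{i,t})² - h²_{i,t}` is minus the oscillatory integral
`∫₀ᵗ aᵢᵏ(s)(Gᵢ(x,s) + F_{i,1}(x,s,a₁ᵏ(s)) + F_{i,2}(x,s,a₂ᵏ(s))) ds` minus its limit, where by
the affine dependence of `∇p[bv,f]` on `b²` (`NavierStokesInequalityPressureScaling`) the printed
`F_{i,l}(x,s,b) = 2vᵢ·∇p[bv_l,h_{l,s}]` splits as `2vᵢ·∇p[0,h_{l,s}] - 2b² vᵢ·F[v_l,h_{l,s}]`: the
`b`-independent part joins `Gᵢ` and `F_{i,l}(x,s,b) = b² f_{i,l}(s,x)` is an explicit even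
polynomial in `b`. Theorem 4.3 (the tree's `Scheffer.exists_oscillatoryProcesses`, PROVED) then
gives the uniform convergence (4.22); and since `x`-derivatives pass under the time integral
(`NavierStokesInequalityProfileIntegrals`) and preserve the shape `b² f`, the same theorem applied
to the differentiated families gives the convergence of the derivatives — Ożański's (4.18),
"`D^l qᵏ_{i,t} → D^l h_{i,t}` uniformly in `P × [0,T]`" (§4.3: the argument applies verbatim to
`D^l Gᵢ`, `D^l F_{i,l}` in place of `Gᵢ`, `F_{i,l}`). This file PROVES:

* `oscIntegral a g f k i t x = ∫₀ᵗ aᵢᵏ(s)(gᵢ(s,x) + a₁ᵏ(s)² f_{i,1}(s,x) + a₂ᵏ(s)² f_{i,2}(s,x)) ds`,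
  `oscLimit f i t x` (`= ½∫₀ᵗ f_{2,1}(s,x) ds` for `i = 2`, `0` for `i = 1`; (4.22)), and
  `oscError = oscIntegral - oscLimit`;
* `IsOscFamily T a` — smooth processes `aᵢᵏ ∈ C^∞(ℝ;[-1,1])` satisfying the conclusion of
  Theorem 4.3 on the plane; `exists_isOscFamily` (from `Scheffer.exists_oscillatoryProcesses`);
* `IsOscFamily.oscError_small` — for continuous families `g, f` and a compact set `P` of
  parameters, `oscError → 0` uniformly on `P × [0,T]` ((4.22));
* `derivR_oscError`, `derivZ_oscError` — planar derivatives of `oscError` in `x` are the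
  `oscError` of the differentiated families ((4.18), mechanism);
* `IsOscFamily.oscError_small_two` — **`oscError` and all its planar `x`-derivatives of order
  `≤ 2` are `≤ ε` on `P × [0,T]` for `k ≥ K(ε)`** ((4.18) up to order two, which is what (4.27)
  consumes through the first lemma of Appendix A.3);
* `opNorm_le_of_basis`, `norm_fderiv_le_abs_add`, `norm_fderiv_fderiv_le` — operator norms on
  `ℝ²` bounded by coordinate partials (to feed `exists_planePressure_sub_le`).

## References

* W. S. Ożański, *On weak solutions to the Navier–Stokes inequality with internal
  singularities*, arXiv:1709.00602v4, §4.1 (4.16)–(4.18), §4.3 (4.22) and Theorem 4.3 (held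
  plain-text rendering: Theorem 10). [`Ozanski2017NSISingular`]
* V. Scheffer, *A solution to the Navier–Stokes inequality with an internal singularity*,
  Comm. Math. Phys. 101 (1985), Lemma 3.2 ((3.42)–(3.58)). [`Scheffer1985`]
-/

noncomputable section

open Set Function Filter Topology Metric MeasureTheory intervalIntegral
open scoped ContDiff

namespace Literature.Barriers.NavierStokesRegularity

-- nested operator types `ℝ² →L[ℝ] ℝ² →L[ℝ] ℝ` (second derivatives)
set_option maxSynthPendingDepth 3

/-! ### Operator norms on `ℝ²` through the coordinate vectors -/

/-- `‖L‖ ≤ ‖L(1,0)‖ + ‖L(0,1)‖` for a continuous linear map on `ℝ × ℝ` (sup norm). [folklore] -/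
theorem opNorm_le_of_basis {F : Type*} [NormedAddCommGroup F] [NormedSpace ℝ F]
    (L : ℝ × ℝ →L[ℝ] F) : ‖L‖ ≤ ‖L (1, 0)‖ + ‖L (0, 1)‖ := by
  refine ContinuousLinearMap.opNorm_le_bound _ (by positivity) fun p => ?_
  have hp : p = p.1 • ((1 : ℝ), (0 : ℝ)) + p.2 • ((0 : ℝ), (1 : ℝ)) := by ext <;> simp
  have h1 : |p.1| ≤ ‖p‖ := by rw [← Real.norm_eq_abs]; exact norm_fst_le p
  have h2 : |p.2| ≤ ‖p‖ := by rw [← Real.norm_eq_abs]; exact norm_snd_le p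
  calc ‖L p‖ = ‖p.1 • L (1, 0) + p.2 • L (0, 1)‖ := by
        conv_lhs => rw [hp]
        rw [map_add, map_smul, map_smul]
    _ ≤ ‖p.1 • L (1, 0)‖ + ‖p.2 • L (0, 1)‖ := norm_add_le _ _
    _ = |p.1| * ‖L (1, 0)‖ + |p.2| * ‖L (0, 1)‖ := by
        rw [norm_smul, norm_smul, Real.norm_eq_abs, Real.norm_eq_abs]
    _ ≤ ‖p‖ * ‖L (1, 0)‖ + ‖p‖ * ‖L (0, 1)‖ := by gcongr
    _ = (‖L (1, 0)‖ + ‖L (0, 1)‖) * ‖p‖ := by ring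

/-- `‖Dσ(q)‖ ≤ |∂ᵣσ(q)| + |∂_zσ(q)|`. [folklore] -/
theorem norm_fderiv_le_abs_add (σ : ℝ × ℝ → ℝ) (q : ℝ × ℝ) :
    ‖fderiv ℝ σ q‖ ≤ |derivR σ q| + |derivZ σ q| := by
  have := opNorm_le_of_basis (fderiv ℝ σ q)
  simpa [derivR, derivZ, Real.norm_eq_abs] using this

/-- Mixed second partials through the second derivative: `D²σ(q) e e' = ∂_e(∂_{e'}σ)(q)`.
[folklore] -/
theorem fderiv_fderiv_apply_eq {σ : ℝ × ℝ → ℝ} {q : ℝ × ℝ} (hd : DifferentiableAt ℝ (fderiv ℝ σ) q)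
    (e e' : ℝ × ℝ) : fderiv ℝ (fderiv ℝ σ) q e e' = fderiv ℝ (fun q' => fderiv ℝ σ q' e') q e := by
  rw [fderiv_clm_apply hd (differentiableAt_const _)]
  simp only [fderiv_fun_const, Pi.zero_apply, ContinuousLinearMap.comp_zero, zero_add]
  rw [ContinuousLinearMap.flip_apply]

/-- **`‖D²σ(q)‖ ≤ |∂ᵣ∂ᵣσ| + |∂ᵣ∂_zσ| + |∂_z∂ᵣσ| + |∂_z∂_zσ|`** (all at `q`), for `σ ∈ C²`.
[folklore] -/
theorem norm_fderiv_fderiv_le {σ : ℝ × ℝ → ℝ} (hσ : ContDiff ℝ 2 σ) (q : ℝ × ℝ) :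
    ‖fderiv ℝ (fderiv ℝ σ) q‖ ≤ |derivR (derivR σ) q| + |derivR (derivZ σ) q| +
      (|derivZ (derivR σ) q| + |derivZ (derivZ σ) q|) := by
  have hd : DifferentiableAt ℝ (fderiv ℝ σ) q :=
    ((hσ.fderiv_right (m := 1) le_rfl).differentiable one_ne_zero) q
  have key : ∀ e : ℝ × ℝ, ‖fderiv ℝ (fderiv ℝ σ) q e‖ ≤
      |fderiv ℝ (derivR σ) q e| + |fderiv ℝ (derivZ σ) q e| := by
    intro e
    have h := opNorm_le_of_basis (fderiv ℝ (fderiv ℝ σ) q e)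
    rw [Real.norm_eq_abs, Real.norm_eq_abs, fderiv_fderiv_apply_eq hd, fderiv_fderiv_apply_eq hd] at h
    exact h
  calc ‖fderiv ℝ (fderiv ℝ σ) q‖
      ≤ ‖fderiv ℝ (fderiv ℝ σ) q (1, 0)‖ + ‖fderiv ℝ (fderiv ℝ σ) q (0, 1)‖ := opNorm_le_of_basis _
    _ ≤ (|fderiv ℝ (derivR σ) q (1, 0)| + |fderiv ℝ (derivZ σ) q (1, 0)|) +
          (|fderiv ℝ (derivR σ) q (0, 1)| + |fderiv ℝ (derivZ σ) q (0, 1)|) :=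
        add_le_add (key _) (key _)
    _ = |derivR (derivR σ) q| + |derivR (derivZ σ) q| +
          (|derivZ (derivR σ) q| + |derivZ (derivZ σ) q|) := rfl

/-- If `σ = 0` near `q` then `Dσ(q) = 0` and `D²σ(q) = 0`. [folklore] -/
theorem fderiv_eq_zero_of_eventuallyEq_zero {σ : ℝ × ℝ → ℝ} {q : ℝ × ℝ}
    (h : σ =ᶠ[𝓝 q] fun _ => 0) : fderiv ℝ σ q = 0 ∧ fderiv ℝ (fderiv ℝ σ) q = 0 := by
  have h1 : fderiv ℝ σ =ᶠ[𝓝 q] fun _ => 0 := by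
    filter_upwards [h.eventuallyEq_nhds] with q' hq'
    rw [hq'.fderiv_eq]; simp
  refine ⟨?_, ?_⟩
  · rw [h.fderiv_eq]; simp
  · rw [h1.fderiv_eq]; simp

/-! ### The oscillatory integrals in expanded form -/

/-- **The oscillatory integral of (4.16), expanded in the direction factors**:
`∫₀ᵗ aᵢᵏ(s) (gᵢ(s,x) + a₁ᵏ(s)² f_{i,1}(s,x) + a₂ᵏ(s)² f_{i,2}(s,x)) ds`
(`= ∫₀ᵗ aᵢᵏ (Gᵢ + F_{i,1}(a₁ᵏ) + F_{i,2}(a₂ᵏ)) ds` with `F_{i,l}(x,s,b) = b² f_{i,l}(s,x)`).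
Indices `i ∈ Fin 2` (`0 ↦ 1`, `1 ↦ 2`). [cite: Ozanski2017NSISingular, §4.1 (4.16) and §4.3 (4.22)] -/
def oscIntegral (a : ℕ → Fin 2 → ℝ → ℝ) (g : Fin 2 → ℝ → ℝ × ℝ → ℝ)
    (f : Fin 2 → Fin 2 → ℝ → ℝ × ℝ → ℝ) (k : ℕ) (i : Fin 2) (t : ℝ) (x : ℝ × ℝ) : ℝ :=
  ∫ s in (0 : ℝ)..t, a k i s * (g i s x + a k 0 s ^ 2 * f i 0 s x + a k 1 s ^ 2 * f i 1 s x)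

/-- **The limit (4.22)**: `½∫₀ᵗ (F_{2,1}(x,s,1) - F_{2,1}(x,s,0)) ds = ½∫₀ᵗ f_{2,1}(s,x) ds` for
`i = 2`, and `0` for `i = 1`. [cite: Ozanski2017NSISingular, §4.3 (4.22)] -/
def oscLimit (f : Fin 2 → Fin 2 → ℝ → ℝ × ℝ → ℝ) (i : Fin 2) (t : ℝ) (x : ℝ × ℝ) : ℝ :=
  if i = 1 then 1 / 2 * ∫ s in (0 : ℝ)..t, f 1 0 s x else 0

/-- The error `oscIntegral - oscLimit` (what (4.22) makes small).
[cite: Ozanski2017NSISingular, §4.3 (4.22)] -/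
def oscError (a : ℕ → Fin 2 → ℝ → ℝ) (g : Fin 2 → ℝ → ℝ × ℝ → ℝ)
    (f : Fin 2 → Fin 2 → ℝ → ℝ × ℝ → ℝ) (k : ℕ) (i : Fin 2) (t : ℝ) (x : ℝ × ℝ) : ℝ :=
  oscIntegral a g f k i t x - oscLimit f i t x

/-- **Oscillatory processes on the plane**: smooth `aᵢᵏ ∈ C^∞(ℝ;[-1,1])` such that for every
set `P ⊆ ℝ²` and all bounded, uniformly continuous `Gᵢ`, `F_{i,l}` (on `P × [0,T]`,
`P × [0,T] × [-1,1]`) with `F_{i,l}(x,s,-1) = F_{i,l}(x,s,1)`, the integrals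
`∫₀ᵗ aᵢᵏ(Gᵢ + F_{i,1}(a₁ᵏ) + F_{i,2}(a₂ᵏ)) ds` converge uniformly on `P × [0,T]` to
`½∫₀ᵗ(F_{2,1}(·,·,1) - F_{2,1}(·,·,0))` (`i = 2`) and `0` (`i = 1`) — the conclusion of
Theorem 4.3 (held: Theorem 10). [cite: Ozanski2017NSISingular, Theorem 4.3] -/
def IsOscFamily (T : ℝ) (a : ℕ → Fin 2 → ℝ → ℝ) : Prop :=
  (∀ k i, ContDiff ℝ ∞ (a k i)) ∧ (∀ k i s, a k i s ∈ Icc (-1 : ℝ) 1) ∧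
    ∀ (P : Set (ℝ × ℝ)) (G : Fin 2 → ℝ × ℝ → ℝ → ℝ) (F : Fin 2 → Fin 2 → ℝ × ℝ → ℝ → ℝ → ℝ),
      (∃ N, (∀ i, ∀ x ∈ P, ∀ s ∈ Icc 0 T, |G i x s| ≤ N) ∧
        ∀ i l, ∀ x ∈ P, ∀ s ∈ Icc 0 T, ∀ b ∈ Icc (-1 : ℝ) 1, |F i l x s b| ≤ N) →
      (∀ i, UniformContinuousOn (fun p : (ℝ × ℝ) × ℝ => G i p.1 p.2) (P ×ˢ Icc 0 T)) →
      (∀ i l, UniformContinuousOn (fun p : (ℝ × ℝ) × ℝ × ℝ => F i l p.1 p.2.1 p.2.2)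
        (P ×ˢ Icc 0 T ×ˢ Icc (-1) 1)) →
      (∀ i l, ∀ x ∈ P, ∀ s ∈ Icc 0 T, F i l x s (-1) = F i l x s 1) →
      ∀ ε > 0, ∃ K : ℕ, ∀ k ≥ K, ∀ x ∈ P, ∀ t ∈ Icc 0 T,
        |(∫ s in (0 : ℝ)..t, a k 1 s * (G 1 x s + F 1 0 x s (a k 0 s) + F 1 1 x s (a k 1 s))) -
            1 / 2 * ∫ s in (0 : ℝ)..t, (F 1 0 x s 1 - F 1 0 x s 0)| ≤ ε ∧
        |∫ s in (0 : ℝ)..t, a k 0 s * (G 0 x s + F 0 0 x s (a k 0 s) + F 0 1 x s (a k 1 s))| ≤ ε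

/-- **Theorem 4.3 (Ożański 2017): oscillatory processes exist** (the tree's
`Scheffer.exists_oscillatoryProcesses`, specialised to planar parameters).
[cite: Ozanski2017NSISingular, Theorem 4.3] -/
theorem exists_isOscFamily {T : ℝ} (hT : 0 < T) : ∃ a : ℕ → Fin 2 → ℝ → ℝ, IsOscFamily T a := by
  obtain ⟨a, ha, ha1, hspec⟩ := Scheffer.exists_oscillatoryProcesses hT
  exact ⟨a, ha, ha1, fun P G F hb hG hF hs => hspec P G F hb hG hF hs⟩

namespace IsOscFamily

variable {T : ℝ} {a : ℕ → Fin 2 → ℝ → ℝ}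

/-- The processes are smooth. [cite: Ozanski2017NSISingular, Theorem 4.3] -/
theorem contDiff (ha : IsOscFamily T a) (k : ℕ) (i : Fin 2) : ContDiff ℝ ∞ (a k i) := ha.1 k i

/-- `|aᵢᵏ| ≤ 1`. [cite: Ozanski2017NSISingular, Theorem 4.3] -/
theorem abs_le (ha : IsOscFamily T a) (k : ℕ) (i : Fin 2) (s : ℝ) : |a k i s| ≤ 1 :=
  _root_.abs_le.2 (ha.2.1 k i s)

/-- `aᵢᵏ(s)² ≤ 1`. [folklore] -/
theorem sq_le (ha : IsOscFamily T a) (k : ℕ) (i : Fin 2) (s : ℝ) : a k i s ^ 2 ≤ 1 := by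
  have h := ha.2.1 k i s
  nlinarith [h.1, h.2]

/-- **(4.22) for continuous families on a compact parameter set**: if `gᵢ`, `f_{i,l}` are
jointly continuous in `(s,x)` and `P` is compact, then for every `ε > 0` there is `K` with
`|oscError a g f k i t x| ≤ ε` for all `k ≥ K`, `x ∈ P`, `t ∈ [0,T]`, `i` (boundedness and
uniform continuity on the compact `P × [0,T] × [-1,1]` being automatic, and `b² f` even in `b`).
[cite: Ozanski2017NSISingular, §4.3 (4.22) and Theorem 4.3] -/
theorem oscError_small (ha : IsOscFamily T a) {P : Set (ℝ × ℝ)} (hP : IsCompact P)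
    {g : Fin 2 → ℝ → ℝ × ℝ → ℝ} {f : Fin 2 → Fin 2 → ℝ → ℝ × ℝ → ℝ}
    (hg : ∀ i, Continuous (uncurry (g i))) (hf : ∀ i l, Continuous (uncurry (f i l))) :
    ∀ ε > 0, ∃ K : ℕ, ∀ k ≥ K, ∀ x ∈ P, ∀ t ∈ Icc (0 : ℝ) T, ∀ i,
      |oscError a g f k i t x| ≤ ε := by
  intro ε hε
  -- the printed data `Gᵢ(x,s) = gᵢ(s,x)`, `F_{i,l}(x,s,b) = b² f_{i,l}(s,x)`
  set G : Fin 2 → ℝ × ℝ → ℝ → ℝ := fun i x s => g i s x with hG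
  set F : Fin 2 → Fin 2 → ℝ × ℝ → ℝ → ℝ → ℝ := fun i l x s b => b ^ 2 * f i l s x with hF
  have hK1 : IsCompact (P ×ˢ Icc (0 : ℝ) T) := hP.prod isCompact_Icc
  have hK2 : IsCompact (P ×ˢ Icc (0 : ℝ) T ×ˢ Icc (-1 : ℝ) 1) :=
    hP.prod (isCompact_Icc.prod isCompact_Icc)
  have hGc : ∀ i, Continuous fun p : (ℝ × ℝ) × ℝ => G i p.1 p.2 := fun i =>
    (hg i).comp (continuous_snd.prodMk continuous_fst)
  have hFc : ∀ i l, Continuous fun p : (ℝ × ℝ) × ℝ × ℝ => F i l p.1 p.2.1 p.2.2 := fun i l =>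
    ((continuous_snd.comp continuous_snd).pow 2).mul
      ((hf i l).comp ((continuous_fst.comp continuous_snd).prodMk continuous_fst))
  -- bounds
  have hbG : ∀ i, ∃ N, ∀ p ∈ P ×ˢ Icc (0 : ℝ) T, |G i p.1 p.2| ≤ N := fun i => by
    obtain ⟨N, hN⟩ := hK1.exists_bound_of_continuousOn (hGc i).continuousOn
    exact ⟨N, fun p hp => (Real.norm_eq_abs _).symm.le.trans (hN p hp)⟩
  have hbF : ∀ i l, ∃ N, ∀ p ∈ P ×ˢ Icc (0 : ℝ) T ×ˢ Icc (-1 : ℝ) 1, |F i l p.1 p.2.1 p.2.2| ≤ N :=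
    fun i l => by
    obtain ⟨N, hN⟩ := hK2.exists_bound_of_continuousOn (hFc i l).continuousOn
    exact ⟨N, fun p hp => (Real.norm_eq_abs _).symm.le.trans (hN p hp)⟩
  choose NG hNG using hbG
  choose NF hNF using hbF
  set N : ℝ := max (max (NG 0) (NG 1)) (max (max (NF 0 0) (NF 0 1)) (max (NF 1 0) (NF 1 1)))
  have hNG' : ∀ i, NG i ≤ N := fun i => by
    fin_cases i
    · exact (le_max_left _ _).trans (le_max_left _ _)
    · exact (le_max_right _ _).trans (le_max_left _ _)
  have hNF' : ∀ i l, NF i l ≤ N := fun i l => by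
    fin_cases i <;> fin_cases l
    · exact ((le_max_left _ _).trans (le_max_left _ _)).trans (le_max_right _ _)
    · exact ((le_max_right _ _).trans (le_max_left _ _)).trans (le_max_right _ _)
    · exact ((le_max_left _ _).trans (le_max_right _ _)).trans (le_max_right _ _)
    · exact ((le_max_right _ _).trans (le_max_right _ _)).trans (le_max_right _ _)
  have hb : ∃ N, (∀ i, ∀ x ∈ P, ∀ s ∈ Icc 0 T, |G i x s| ≤ N) ∧
      ∀ i l, ∀ x ∈ P, ∀ s ∈ Icc 0 T, ∀ b ∈ Icc (-1 : ℝ) 1, |F i l x s b| ≤ N :=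
    ⟨N, fun i x hx s hs => (hNG i (x, s) ⟨hx, hs⟩).trans (hNG' i),
      fun i l x hx s hs b hb => (hNF i l (x, s, b) ⟨hx, hs, hb⟩).trans (hNF' i l)⟩
  have huG : ∀ i, UniformContinuousOn (fun p : (ℝ × ℝ) × ℝ => G i p.1 p.2) (P ×ˢ Icc 0 T) :=
    fun i => hK1.uniformContinuousOn_of_continuous (hGc i).continuousOn
  have huF : ∀ i l, UniformContinuousOn (fun p : (ℝ × ℝ) × ℝ × ℝ => F i l p.1 p.2.1 p.2.2)
      (P ×ˢ Icc 0 T ×ˢ Icc (-1) 1) :=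
    fun i l => hK2.uniformContinuousOn_of_continuous (hFc i l).continuousOn
  have hsymm : ∀ i l, ∀ x ∈ P, ∀ s ∈ Icc (0 : ℝ) T, F i l x s (-1) = F i l x s 1 := by
    intro i l x _ s _; simp [hF]
  obtain ⟨K, hK⟩ := ha.2.2 P G F hb huG huF hsymm ε hε
  refine ⟨K, fun k hk x hx t ht i => ?_⟩
  obtain ⟨h1, h0⟩ := hK k hk x hx t ht
  fin_cases i
  · simpa [oscError, oscIntegral, oscLimit, hG, hF] using h0
  · have e : (fun s => F 1 0 x s 1 - F 1 0 x s 0) = fun s => f 1 0 s x := by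
      funext s; simp [hF]
    rw [e] at h1
    simpa [oscError, oscIntegral, oscLimit, hG, hF] using h1

end IsOscFamily

/-! ### Planar derivatives of the oscillatory integrals -/

section Deriv

variable {T : ℝ} {a : ℕ → Fin 2 → ℝ → ℝ} {g : Fin 2 → ℝ → ℝ × ℝ → ℝ}
  {f : Fin 2 → Fin 2 → ℝ → ℝ × ℝ → ℝ}

/-- The differentiated families `∂ᵣgᵢ`, `∂ᵣf_{i,l}` (in `x`). [folklore] -/
def dR (g : Fin 2 → ℝ → ℝ × ℝ → ℝ) : Fin 2 → ℝ → ℝ × ℝ → ℝ := fun i s x => derivR (g i s) x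

/-- The differentiated families `∂_zgᵢ`, `∂_zf_{i,l}` (in `x`). [folklore] -/
def dZ (g : Fin 2 → ℝ → ℝ × ℝ → ℝ) : Fin 2 → ℝ → ℝ × ℝ → ℝ := fun i s x => derivZ (g i s) x

/-- `∂ᵣ` on the second family index. [folklore] -/
def dR₂ (f : Fin 2 → Fin 2 → ℝ → ℝ × ℝ → ℝ) : Fin 2 → Fin 2 → ℝ → ℝ × ℝ → ℝ :=
  fun i l s x => derivR (f i l s) x

/-- `∂_z` on the second family index. [folklore] -/
def dZ₂ (f : Fin 2 → Fin 2 → ℝ → ℝ × ℝ → ℝ) : Fin 2 → Fin 2 → ℝ → ℝ × ℝ → ℝ :=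
  fun i l s x => derivZ (f i l s) x

/-- `∂ᵣ` of a jointly smooth family is jointly smooth. [folklore] -/
theorem contDiff_dR (hg : ∀ i, ContDiff ℝ ∞ (uncurry (g i))) (i : Fin 2) :
    ContDiff ℝ ∞ (uncurry (dR g i)) :=
  (hg i).derivR_param (P := g i)

/-- `∂_z` of a jointly smooth family is jointly smooth. [folklore] -/
theorem contDiff_dZ (hg : ∀ i, ContDiff ℝ ∞ (uncurry (g i))) (i : Fin 2) :
    ContDiff ℝ ∞ (uncurry (dZ g i)) :=
  (hg i).derivZ_param (P := g i)

/-- `∂ᵣ` of a jointly smooth family is jointly smooth. [folklore] -/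
theorem contDiff_dR₂ (hf : ∀ i l, ContDiff ℝ ∞ (uncurry (f i l))) (i l : Fin 2) :
    ContDiff ℝ ∞ (uncurry (dR₂ f i l)) :=
  (hf i l).derivR_param (P := f i l)

/-- `∂_z` of a jointly smooth family is jointly smooth. [folklore] -/
theorem contDiff_dZ₂ (hf : ∀ i l, ContDiff ℝ ∞ (uncurry (f i l))) (i l : Fin 2) :
    ContDiff ℝ ∞ (uncurry (dZ₂ f i l)) :=
  (hf i l).derivZ_param (P := f i l)

/-- The integrand of `oscIntegral` is jointly smooth in `(s,x)`. [folklore] -/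
theorem contDiff_oscIntegrand (ha : IsOscFamily T a) (hg : ∀ i, ContDiff ℝ ∞ (uncurry (g i)))
    (hf : ∀ i l, ContDiff ℝ ∞ (uncurry (f i l))) (k : ℕ) (i : Fin 2) :
    ContDiff ℝ ∞ (uncurry fun (s : ℝ) (x : ℝ × ℝ) =>
      a k i s * (g i s x + a k 0 s ^ 2 * f i 0 s x + a k 1 s ^ 2 * f i 1 s x)) := by
  have hA : ∀ j, ContDiff ℝ ∞ fun p : ℝ × (ℝ × ℝ) => a k j p.1 := fun j =>
    (ha.contDiff k j).comp contDiff_fst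
  exact (hA i).mul (((hg i).add (((hA 0).pow 2).mul (hf i 0))).add (((hA 1).pow 2).mul (hf i 1)))

/-- **`∂ᵣ` of the oscillatory integral is the oscillatory integral of the `∂ᵣ`-families**
(derivatives pass under the time integral and the direction factors are constants in `x`).
[cite: Ozanski2017NSISingular, §4.1 (4.18)] -/
theorem derivR_oscIntegral (ha : IsOscFamily T a) (hg : ∀ i, ContDiff ℝ ∞ (uncurry (g i)))
    (hf : ∀ i l, ContDiff ℝ ∞ (uncurry (f i l))) (k : ℕ) (i : Fin 2) (t : ℝ) (x : ℝ × ℝ) :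
    derivR (oscIntegral a g f k i t) x = oscIntegral a (dR g) (dR₂ f) k i t x := by
  have hΦ := contDiff_oscIntegrand ha hg hf k i
  rw [show oscIntegral a g f k i t = fun x' => ∫ s in (0 : ℝ)..t,
      a k i s * (g i s x' + a k 0 s ^ 2 * f i 0 s x' + a k 1 s ^ 2 * f i 1 s x') from rfl,
    derivR_primitive_param hΦ t x, oscIntegral]
  refine intervalIntegral.integral_congr fun s _ => ?_
  have hgd : DifferentiableAt ℝ (g i s) x := ((hg i).slice_param s).differentiable (by simp) x
  have hf0 : DifferentiableAt ℝ (f i 0 s) x := ((hf i 0).slice_param s).differentiable (by simp) x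
  have hf1 : DifferentiableAt ℝ (f i 1 s) x := ((hf i 1).slice_param s).differentiable (by simp) x
  have hd : HasFDerivAt (fun x' => a k i s * (g i s x' + a k 0 s ^ 2 * f i 0 s x' + a k 1 s ^ 2 * f i 1 s x'))
      (a k i s • (fderiv ℝ (g i s) x + a k 0 s ^ 2 • fderiv ℝ (f i 0 s) x +
        a k 1 s ^ 2 • fderiv ℝ (f i 1 s) x)) x :=
    ((hgd.hasFDerivAt.add (hf0.hasFDerivAt.const_mul _)).add (hf1.hasFDerivAt.const_mul _)).const_mul _
  simp only [dR, dR₂, derivR]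
  rw [hd.fderiv]
  simp only [FunLike.coe_smul, Pi.smul_apply, _root_.add_apply, smul_eq_mul]

/-- **`∂_z` of the oscillatory integral is the oscillatory integral of the `∂_z`-families.**
[cite: Ozanski2017NSISingular, §4.1 (4.18)] -/
theorem derivZ_oscIntegral (ha : IsOscFamily T a) (hg : ∀ i, ContDiff ℝ ∞ (uncurry (g i)))
    (hf : ∀ i l, ContDiff ℝ ∞ (uncurry (f i l))) (k : ℕ) (i : Fin 2) (t : ℝ) (x : ℝ × ℝ) :
    derivZ (oscIntegral a g f k i t) x = oscIntegral a (dZ g) (dZ₂ f) k i t x := by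
  have hΦ := contDiff_oscIntegrand ha hg hf k i
  rw [show oscIntegral a g f k i t = fun x' => ∫ s in (0 : ℝ)..t,
      a k i s * (g i s x' + a k 0 s ^ 2 * f i 0 s x' + a k 1 s ^ 2 * f i 1 s x') from rfl,
    derivZ_primitive_param hΦ t x, oscIntegral]
  refine intervalIntegral.integral_congr fun s _ => ?_
  have hgd : DifferentiableAt ℝ (g i s) x := ((hg i).slice_param s).differentiable (by simp) x
  have hf0 : DifferentiableAt ℝ (f i 0 s) x := ((hf i 0).slice_param s).differentiable (by simp) x
  have hf1 : DifferentiableAt ℝ (f i 1 s) x := ((hf i 1).slice_param s).differentiable (by simp) x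
  have hd : HasFDerivAt (fun x' => a k i s * (g i s x' + a k 0 s ^ 2 * f i 0 s x' + a k 1 s ^ 2 * f i 1 s x'))
      (a k i s • (fderiv ℝ (g i s) x + a k 0 s ^ 2 • fderiv ℝ (f i 0 s) x +
        a k 1 s ^ 2 • fderiv ℝ (f i 1 s) x)) x :=
    ((hgd.hasFDerivAt.add (hf0.hasFDerivAt.const_mul _)).add (hf1.hasFDerivAt.const_mul _)).const_mul _
  simp only [dZ, dZ₂, derivZ]
  rw [hd.fderiv]
  simp only [FunLike.coe_smul, Pi.smul_apply, _root_.add_apply, smul_eq_mul]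

/-- `∂ᵣ` of the limit is the limit of the `∂ᵣ`-family. [cite: Ozanski2017NSISingular, §4.1 (4.18)] -/
theorem derivR_oscLimit (hf : ∀ i l, ContDiff ℝ ∞ (uncurry (f i l))) (i : Fin 2) (t : ℝ)
    (x : ℝ × ℝ) : derivR (oscLimit f i t) x = oscLimit (dR₂ f) i t x := by
  by_cases hi : i = 1
  · subst hi
    have hP : ContDiff ℝ ∞ fun x' : ℝ × ℝ => ∫ s in (0 : ℝ)..t, f 1 0 s x' :=
      (contDiff_primitive_param (hf 1 0)).comp (contDiff_prodMk_right t)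
    have hd := (hP.differentiable (by simp) x).hasFDerivAt.const_mul (1 / 2 : ℝ)
    rw [show oscLimit f 1 t = fun x' => 1 / 2 * ∫ s in (0 : ℝ)..t, f 1 0 s x' from by
      funext x'; simp [oscLimit], derivR, hd.fderiv]
    simp only [oscLimit, if_true, dR₂, FunLike.coe_smul, Pi.smul_apply, smul_eq_mul]
    rw [← derivR, derivR_primitive_param (hf 1 0) t x]
  · have e1 : oscLimit f i t = fun _ => 0 := by funext x'; simp [oscLimit, hi]
    have e2 : oscLimit (dR₂ f) i t x = 0 := by simp [oscLimit, hi]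
    rw [e1, e2, derivR]; simp

/-- `∂_z` of the limit is the limit of the `∂_z`-family. [cite: Ozanski2017NSISingular, §4.1 (4.18)] -/
theorem derivZ_oscLimit (hf : ∀ i l, ContDiff ℝ ∞ (uncurry (f i l))) (i : Fin 2) (t : ℝ)
    (x : ℝ × ℝ) : derivZ (oscLimit f i t) x = oscLimit (dZ₂ f) i t x := by
  by_cases hi : i = 1
  · subst hi
    have hP : ContDiff ℝ ∞ fun x' : ℝ × ℝ => ∫ s in (0 : ℝ)..t, f 1 0 s x' :=
      (contDiff_primitive_param (hf 1 0)).comp (contDiff_prodMk_right t)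
    have hd := (hP.differentiable (by simp) x).hasFDerivAt.const_mul (1 / 2 : ℝ)
    rw [show oscLimit f 1 t = fun x' => 1 / 2 * ∫ s in (0 : ℝ)..t, f 1 0 s x' from by
      funext x'; simp [oscLimit], derivZ, hd.fderiv]
    simp only [oscLimit, if_true, dZ₂, FunLike.coe_smul, Pi.smul_apply, smul_eq_mul]
    rw [← derivZ, derivZ_primitive_param (hf 1 0) t x]
  · have e1 : oscLimit f i t = fun _ => 0 := by funext x'; simp [oscLimit, hi]
    have e2 : oscLimit (dZ₂ f) i t x = 0 := by simp [oscLimit, hi]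
    rw [e1, e2, derivZ]; simp

/-- The oscillatory integral is differentiable in `x`. [folklore] -/
theorem differentiable_oscIntegral (ha : IsOscFamily T a) (hg : ∀ i, ContDiff ℝ ∞ (uncurry (g i)))
    (hf : ∀ i l, ContDiff ℝ ∞ (uncurry (f i l))) (k : ℕ) (i : Fin 2) (t : ℝ) :
    Differentiable ℝ (oscIntegral a g f k i t) :=
  ((contDiff_primitive_param (contDiff_oscIntegrand ha hg hf k i)).comp
    (contDiff_prodMk_right t)).differentiable (by simp)

/-- The limit is differentiable in `x`. [folklore] -/
theorem differentiable_oscLimit (hf : ∀ i l, ContDiff ℝ ∞ (uncurry (f i l))) (i : Fin 2) (t : ℝ) :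
    Differentiable ℝ (oscLimit f i t) := by
  by_cases hi : i = 1
  · subst hi
    have hP : ContDiff ℝ ∞ fun x' : ℝ × ℝ => ∫ s in (0 : ℝ)..t, f 1 0 s x' :=
      (contDiff_primitive_param (hf 1 0)).comp (contDiff_prodMk_right t)
    rw [show oscLimit f 1 t = fun x' => 1 / 2 * ∫ s in (0 : ℝ)..t, f 1 0 s x' from by
      funext x'; simp [oscLimit]]
    exact (hP.differentiable (by simp)).const_mul _
  · rw [show oscLimit f i t = fun _ => 0 from by funext x'; simp [oscLimit, hi]]
    exact differentiable_const _

/-- **`∂ᵣ(oscError) = oscError` of the `∂ᵣ`-families.** [cite: Ozanski2017NSISingular, §4.1 (4.18)] -/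
theorem derivR_oscError (ha : IsOscFamily T a) (hg : ∀ i, ContDiff ℝ ∞ (uncurry (g i)))
    (hf : ∀ i l, ContDiff ℝ ∞ (uncurry (f i l))) (k : ℕ) (i : Fin 2) (t : ℝ) (x : ℝ × ℝ) :
    derivR (oscError a g f k i t) x = oscError a (dR g) (dR₂ f) k i t x := by
  have h1 := (differentiable_oscIntegral ha hg hf k i t x).hasFDerivAt
  have h2 := (differentiable_oscLimit hf i t x).hasFDerivAt
  rw [show oscError a g f k i t = oscIntegral a g f k i t - oscLimit f i t from rfl,
    derivR, (h1.sub h2).fderiv, _root_.sub_apply, ← derivR, ← derivR,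
    derivR_oscIntegral ha hg hf, derivR_oscLimit hf, oscError]

/-- **`∂_z(oscError) = oscError` of the `∂_z`-families.** [cite: Ozanski2017NSISingular, §4.1 (4.18)] -/
theorem derivZ_oscError (ha : IsOscFamily T a) (hg : ∀ i, ContDiff ℝ ∞ (uncurry (g i)))
    (hf : ∀ i l, ContDiff ℝ ∞ (uncurry (f i l))) (k : ℕ) (i : Fin 2) (t : ℝ) (x : ℝ × ℝ) :
    derivZ (oscError a g f k i t) x = oscError a (dZ g) (dZ₂ f) k i t x := by
  have h1 := (differentiable_oscIntegral ha hg hf k i t x).hasFDerivAt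
  have h2 := (differentiable_oscLimit hf i t x).hasFDerivAt
  rw [show oscError a g f k i t = oscIntegral a g f k i t - oscLimit f i t from rfl,
    derivZ, (h1.sub h2).fderiv, _root_.sub_apply, ← derivZ, ← derivZ,
    derivZ_oscIntegral ha hg hf, derivZ_oscLimit hf, oscError]

/-- `(t,x) ↦ oscError` is jointly `C^∞`, hence each slice `oscError a g f k i t` is `C^∞` in
`x`. [folklore] -/
theorem contDiff_oscError (ha : IsOscFamily T a) (hg : ∀ i, ContDiff ℝ ∞ (uncurry (g i)))
    (hf : ∀ i l, ContDiff ℝ ∞ (uncurry (f i l))) (k : ℕ) (i : Fin 2) (t : ℝ) :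
    ContDiff ℝ ∞ (oscError a g f k i t) := by
  have h1 : ContDiff ℝ ∞ (oscIntegral a g f k i t) :=
    (contDiff_primitive_param (contDiff_oscIntegrand ha hg hf k i)).comp (contDiff_prodMk_right t)
  have h2 : ContDiff ℝ ∞ (oscLimit f i t) := by
    by_cases hi : i = 1
    · subst hi
      have hP : ContDiff ℝ ∞ fun x' : ℝ × ℝ => ∫ s in (0 : ℝ)..t, f 1 0 s x' :=
        (contDiff_primitive_param (hf 1 0)).comp (contDiff_prodMk_right t)
      rw [show oscLimit f 1 t = fun x' => 1 / 2 * ∫ s in (0 : ℝ)..t, f 1 0 s x' from by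
        funext x'; simp [oscLimit]]
      exact contDiff_const.mul hP
    · rw [show oscLimit f i t = fun _ => 0 from by funext x'; simp [oscLimit, hi]]
      exact contDiff_const
  exact h1.sub h2

end Deriv

/-! ### (4.18) up to order two -/

namespace IsOscFamily

variable {T : ℝ} {a : ℕ → Fin 2 → ℝ → ℝ}

/-- **(4.18), orders `0, 1, 2`: the oscillatory error and all its planar derivatives up to order
two are uniformly small on `P × [0,T]` for `k` large**, for jointly smooth families and a
compact parameter set `P` (seven applications of (4.22): to `(g,f)` and to its `∂ᵣ`, `∂_z`,
`∂ᵣ∂ᵣ`, `∂ᵣ∂_z`, `∂_z∂ᵣ`, `∂_z∂_z` transforms).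
[cite: Ozanski2017NSISingular, §4.1 (4.18) and §4.3 (4.22)] -/
theorem oscError_small_two (ha : IsOscFamily T a) {P : Set (ℝ × ℝ)} (hP : IsCompact P)
    {g : Fin 2 → ℝ → ℝ × ℝ → ℝ} {f : Fin 2 → Fin 2 → ℝ → ℝ × ℝ → ℝ}
    (hg : ∀ i, ContDiff ℝ ∞ (uncurry (g i))) (hf : ∀ i l, ContDiff ℝ ∞ (uncurry (f i l))) :
    ∀ ε > 0, ∃ K : ℕ, ∀ k ≥ K, ∀ x ∈ P, ∀ t ∈ Icc (0 : ℝ) T, ∀ i,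
      |oscError a g f k i t x| ≤ ε ∧
      |derivR (oscError a g f k i t) x| ≤ ε ∧ |derivZ (oscError a g f k i t) x| ≤ ε ∧
      |derivR (derivR (oscError a g f k i t)) x| ≤ ε ∧
      |derivR (derivZ (oscError a g f k i t)) x| ≤ ε ∧
      |derivZ (derivR (oscError a g f k i t)) x| ≤ ε ∧
      |derivZ (derivZ (oscError a g f k i t)) x| ≤ ε := by
  intro ε hε
  -- smoothness of the transformed families
  have hgR := contDiff_dR hg
  have hgZ := contDiff_dZ hg
  have hfR := contDiff_dR₂ hf
  have hfZ := contDiff_dZ₂ hf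
  have hgRR := contDiff_dR hgR
  have hgRZ := contDiff_dZ hgR
  have hgZR := contDiff_dR hgZ
  have hgZZ := contDiff_dZ hgZ
  have hfRR := contDiff_dR₂ hfR
  have hfRZ := contDiff_dZ₂ hfR
  have hfZR := contDiff_dR₂ hfZ
  have hfZZ := contDiff_dZ₂ hfZ
  -- seven thresholds
  have c := fun {g' : Fin 2 → ℝ → ℝ × ℝ → ℝ} {f' : Fin 2 → Fin 2 → ℝ → ℝ × ℝ → ℝ}
      (hg' : ∀ i, ContDiff ℝ ∞ (uncurry (g' i))) (hf' : ∀ i l, ContDiff ℝ ∞ (uncurry (f' i l))) =>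
    ha.oscError_small hP (fun i => (hg' i).continuous) (fun i l => (hf' i l).continuous) ε hε
  obtain ⟨K₀, hK₀⟩ := c hg hf
  obtain ⟨K₁, hK₁⟩ := c hgR hfR
  obtain ⟨K₂, hK₂⟩ := c hgZ hfZ
  obtain ⟨K₃, hK₃⟩ := c hgRR hfRR
  obtain ⟨K₄, hK₄⟩ := c hgRZ hfRZ
  obtain ⟨K₅, hK₅⟩ := c hgZR hfZR
  obtain ⟨K₆, hK₆⟩ := c hgZZ hfZZ
  refine ⟨max (max (max K₀ K₁) (max K₂ K₃)) (max (max K₄ K₅) K₆), fun k hk x hx t ht i => ?_⟩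
  have hk₀ : K₀ ≤ k := le_trans (by simp) hk
  have hk₁ : K₁ ≤ k := le_trans (by simp) hk
  have hk₂ : K₂ ≤ k := le_trans (by simp) hk
  have hk₃ : K₃ ≤ k := le_trans (by simp) hk
  have hk₄ : K₄ ≤ k := le_trans (by simp) hk
  have hk₅ : K₅ ≤ k := le_trans (by simp) hk
  have hk₆ : K₆ ≤ k := le_trans (by simp) hk
  -- identify the derivatives of the error with errors of transformed families
  have eR : derivR (oscError a g f k i t) = oscError a (dR g) (dR₂ f) k i t :=
    funext fun x => derivR_oscError ha hg hf k i t x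
  have eZ : derivZ (oscError a g f k i t) = oscError a (dZ g) (dZ₂ f) k i t :=
    funext fun x => derivZ_oscError ha hg hf k i t x
  refine ⟨hK₀ k hk₀ x hx t ht i, ?_, ?_, ?_, ?_, ?_, ?_⟩
  · rw [eR]; exact hK₁ k hk₁ x hx t ht i
  · rw [eZ]; exact hK₂ k hk₂ x hx t ht i
  · rw [eR, derivR_oscError ha hgR hfR]; exact hK₃ k hk₃ x hx t ht i
  · rw [eZ, derivR_oscError ha hgZ hfZ]; exact hK₅ k hk₅ x hx t ht i
  · rw [eR, derivZ_oscError ha hgR hfR]; exact hK₄ k hk₄ x hx t ht i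
  · rw [eZ, derivZ_oscError ha hgZ hfZ]; exact hK₆ k hk₆ x hx t ht i

end IsOscFamily

end Literature.Barriers.NavierStokesRegularity
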